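import Literature.AnabelianGeometry.AbsoluteAnabelian.AbsTopI.CoFreeCompletionComparison
import HarnessLib

/-!
# [AbsTopI] Prop 4.10 (iii), abstract form: the comparison of co-free completions is an
# isomorphism of TOPOLOGICAL groups under an openness input (v2 topology)

S. Mochizuki, *Topics in Absolute Anabelian Geometry I: Generalities* [AbsTopI] (J. Math. Sci.
Univ. Tokyo 19 (2012)), Prop 4.10 (iii) p. 60 and its one-line proof p. 61 "follows immediately
from (i)" (manuscript pagination, lit key `paper:url-11ac98ba15fc`, read on the page).  Sequel to
`AbsTopI/CoFreeCompletionComparison.lean` (abc-iut-L4-t13), which built the bijective continuous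
comparison homomorphism `compareHom : Π_X^{Q/co-fr} → Π_Y^{Q/co-fr}` from cofinality (both
directions) and image agreement.  Here:

* `kerY`, `fbar H : Π_X ⧸ K_H → Π_Y ⧸ K^Y_H` — the maps `f` descends to (`K_H = f⁻¹(K^Y_H)`,
  `piKer_eq_comap_kerY`), continuous and injective, surjective under image agreement;
* `fbar_kerCoord` — the `Π ⧸ K`-coordinates of `compareHom` factor through `fbar`;
* `continuous_symm_compareHom` — if every `f̄_H` is an OPEN map (e.g. by Mathlib's open mapping
  theorem `MonoidHom.isOpenMap_of_sigmaCompact` for σ-compact locally compact sources and Baire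
  targets — the situation of genuine tempered groups), the inverse of the comparison is continuous
  for the v2 (inverse-limit-of-quotient) topologies;
* `compareEquiv : Π_X^{Q/co-fr} ≃ₜ* Π_Y^{Q/co-fr}` and `exists_equiv_toCoFreeCompletion_eq` — with
  an identification `Π_Y^{Q/co-fr} ≃ₜ* Π_Y` carrying `η_Y` to `id` ((i) for `Y`) one gets
  `e : Π_X^{Q/co-fr} ≃ₜ* Π_Y` with `e ∘ η_X = f`: the SHAPE of Prop 4.10 (iii), reduced to four named
  inputs (cofinality ×2, image agreement, openness) + (i).

HONEST FRAMING: general topology/group theory over the cell's construction; the inputs are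
hypotheses, discharged nowhere here; nothing bears on [IUTchIII] Cor 3.12; typed ≠ proved.
-/

noncomputable section

open Topology

universe u u' v

namespace Literature.AnabelianGeometry.AbsoluteAnabelian.AbsTopI

/-! ### The homeomorphism upgrade: openness of the descended maps `Π_X ⧸ K_H → Π_Y ⧸ f-saturation` -/

section Top

variable {PX : Type u} [Group PX] [TopologicalSpace PX] {PY : Type u'}
  [Group PY] [TopologicalSpace PY] {Q : Type v} [Group Q]
  [TopologicalSpace Q] [IsTopologicalGroup Q]
  {ρX : PX →ₜ* Q} {ρY : PY →ₜ* Q} {ΔX : Subgroup PX} {ΔY : Subgroup PY} {f : PX →ₜ* PY}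

/-- `K^Y_H := ρY⁻¹(X̂-kernel(H)) ⊆ Π_Y`, the `Π_Y`-side kernel attached to an X-index `H`.
[cite: MochizukiAbsTopI2012, Prop 4.10 (iii) p.60] -/
def kerY (ρX : PX →ₜ* Q) (ρY : PY →ₜ* Q) (ΔX : Subgroup PX) (H : CharOpenSubgroup ΔX) :
    Subgroup PY :=
  (coFreeKernel ρX H.toSubgroup).comap ρY.toMonoidHom

/-- `K^Y_H` is normal. [cite: MochizukiAbsTopI2012, Prop 4.10 (iii) p.60] -/
instance kerY_normal (H : CharOpenSubgroup ΔX) : (kerY ρX ρY ΔX H).Normal :=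
  Subgroup.Normal.comap inferInstance _

/-- `K_H = f⁻¹(K^Y_H)` (compatibility `ρY ∘ f = ρX`). [cite: MochizukiAbsTopI2012, Prop 4.10 (iii) p.60] -/
theorem piKer_eq_comap_kerY (hf : ∀ p, ρY (f p) = ρX p) (H : CharOpenSubgroup ΔX) :
    CoFreeCompletion.piKer ρX ΔX H = (kerY ρX ρY ΔX H).comap f.toMonoidHom := by
  ext p
  rw [Subgroup.mem_comap, kerY, Subgroup.mem_comap, MonoidHom.mem_ker]
  change ((ρX p : Q) : CoFreeQuot ρX H.toSubgroup) = 1 ↔ ρY.toMonoidHom (f.toMonoidHom p) ∈ _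
  rw [QuotientGroup.eq_one_iff]
  change _ ↔ ρY (f p) ∈ coFreeKernel ρX H.toSubgroup
  rw [hf]

/-- The descended map `f̄_H : Π_X ⧸ K_H → Π_Y ⧸ K^Y_H`. [cite: MochizukiAbsTopI2012, Prop 4.10 (iii) p.60] -/
def fbar (hf : ∀ p, ρY (f p) = ρX p) (H : CharOpenSubgroup ΔX) :
    PX ⧸ CoFreeCompletion.piKer ρX ΔX H →* PY ⧸ kerY ρX ρY ΔX H :=
  QuotientGroup.map _ _ f.toMonoidHom (piKer_eq_comap_kerY hf H).le

/-- `f̄_H` on classes. [cite: MochizukiAbsTopI2012, Prop 4.10 (iii) p.60] -/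
@[simp] theorem fbar_mk (hf : ∀ p, ρY (f p) = ρX p) (H : CharOpenSubgroup ΔX) (p : PX) :
    fbar hf H (p : PX ⧸ CoFreeCompletion.piKer ρX ΔX H) = ((f p : PY) : PY ⧸ kerY ρX ρY ΔX H) :=
  rfl

/-- `f̄_H` is injective (`K_H = f⁻¹(K^Y_H)`). [cite: MochizukiAbsTopI2012, Prop 4.10 (iii) p.60] -/
theorem fbar_injective (hf : ∀ p, ρY (f p) = ρX p) (H : CharOpenSubgroup ΔX) :
    Function.Injective (fbar hf H) := by
  rw [injective_iff_map_eq_one]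
  intro z hz
  obtain ⟨p, rfl⟩ := QuotientGroup.mk_surjective z
  rw [fbar_mk, QuotientGroup.eq_one_iff] at hz
  rw [QuotientGroup.eq_one_iff, piKer_eq_comap_kerY hf H]
  exact hz

/-- `f̄_H` is surjective under IMAGE AGREEMENT. [cite: MochizukiAbsTopI2012, Prop 4.10 (iii) p.60] -/
theorem fbar_surjective (hf : ∀ p, ρY (f p) = ρX p) (H : CharOpenSubgroup ΔX)
    (hIA : ∀ q : PY, ∃ p : PX,
      ((ρY q : Q) : CoFreeQuot ρX H.toSubgroup) = toCoFreeQuot ρX H.toSubgroup p) :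
    Function.Surjective (fbar hf H) := by
  intro z
  obtain ⟨q, rfl⟩ := QuotientGroup.mk_surjective z
  obtain ⟨p, hp⟩ := hIA q
  refine ⟨(p : PX ⧸ CoFreeCompletion.piKer ρX ΔX H), ?_⟩
  rw [fbar_mk, QuotientGroup.eq, kerY, Subgroup.mem_comap, map_mul, map_inv]
  change (ρY (f p))⁻¹ * ρY q ∈ coFreeKernel ρX H.toSubgroup
  rw [← QuotientGroup.eq, hf]
  exact hp.symm

/-- `K′_{d H} ≤ K^Y_H` when `Ŷ-kernel(d H) ≤ X̂-kernel(H)`: the projection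
`Π_Y ⧸ K′_{d H} → Π_Y ⧸ K^Y_H`. [cite: MochizukiAbsTopI2012, Prop 4.10 (iii) p.60] -/
theorem piKer_le_kerY (H : CharOpenSubgroup ΔX) {H' : CharOpenSubgroup ΔY}
    (h : coFreeKernel ρY H'.toSubgroup ≤ coFreeKernel ρX H.toSubgroup) :
    CoFreeCompletion.piKer ρY ΔY H' ≤ kerY ρX ρY ΔX H := by
  intro q hq
  rw [MonoidHom.mem_ker] at hq
  change ((ρY q : Q) : CoFreeQuot ρY H'.toSubgroup) = 1 at hq
  rw [QuotientGroup.eq_one_iff] at hq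
  exact h hq

/-- Key identity: `f̄_H(coordinate of x at H) = projection of (coordinate of compare x at d H)`.
[cite: MochizukiAbsTopI2012, Prop 4.10 (iii) p.60] -/
theorem fbar_kerCoord (hf : ∀ p, ρY (f p) = ρX p)
    (c : CharOpenSubgroup ΔY → CharOpenSubgroup ΔX)
    (hc : ∀ H', coFreeKernel ρX (c H').toSubgroup ≤ coFreeKernel ρY H'.toSubgroup)
    (d : CharOpenSubgroup ΔX → CharOpenSubgroup ΔY)
    (hd : ∀ H, coFreeKernel ρY (d H).toSubgroup ≤ coFreeKernel ρX H.toSubgroup)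
    (H : CharOpenSubgroup ΔX) (x : CoFreeCompletion ρX ΔX) :
    fbar hf H (CoFreeCompletion.kerCoord H x) =
      QuotientGroup.map _ _ (MonoidHom.id PY) (piKer_le_kerY H (hd H))
        (CoFreeCompletion.kerCoord (d H) (compareHom f hf c hc x)) := by
  obtain ⟨p, hp⟩ := x.exists_toCoFreeQuot_eq_val H
  obtain ⟨q, hq⟩ := (compareHom f hf c hc x).exists_toCoFreeQuot_eq_val (d H)
  rw [CoFreeCompletion.kerCoord_eq_mk hp, CoFreeCompletion.kerCoord_eq_mk hq, fbar_mk,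
    QuotientGroup.map_mk, MonoidHom.id_apply, QuotientGroup.eq, kerY, Subgroup.mem_comap,
    map_mul, map_inv]
  change (ρY (f p))⁻¹ * ρY q ∈ coFreeKernel ρX H.toSubgroup
  rw [← QuotientGroup.eq, hf]
  -- `[ρX p] = x_H` and `[ρY q]` pushed to `Q ⧸ N_H` is also `x_H`
  have h1 : ((ρX p : Q) : CoFreeQuot ρX H.toSubgroup) = x.val H := hp
  have h2 : ((ρY q : Q) : CoFreeQuot ρX H.toSubgroup) =
      qmap (hd H) ((compareHom f hf c hc x).val (d H)) := by
    rw [← hq, toCoFreeQuot_apply, qmap_mk]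
  rw [h1, h2, val_compareHom, qmap_qmap, ← qmap_refl (x.val H)]
  exact x.val_qmap_indep _ _

variable [IsTopologicalGroup PX]

/-- `f̄_H` is continuous. [cite: MochizukiAbsTopI2012, Prop 4.10 (iii) p.60] -/
theorem continuous_fbar (hf : ∀ p, ρY (f p) = ρX p) (H : CharOpenSubgroup ΔX) :
    Continuous (fbar hf H) := by
  apply (QuotientGroup.isOpenQuotientMap_mk
    (N := CoFreeCompletion.piKer ρX ΔX H)).continuous_comp_iff.mp
  exact QuotientGroup.continuous_mk.comp f.continuous

variable [IsTopologicalGroup PY]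

/-- **Continuity of the inverse** of the comparison, given that every descended map `f̄_H` is an
OPEN map (e.g. by the open mapping theorem for σ-compact locally compact groups,
`MonoidHom.isOpenMap_of_sigmaCompact`, once image agreement makes it surjective): then the inverse
bijection `Π_Y^{Q/co-fr} → Π_X^{Q/co-fr}` is continuous. [cite: MochizukiAbsTopI2012, Prop 4.10 (iii) p.60] -/
theorem continuous_symm_compareHom (hf : ∀ p, ρY (f p) = ρX p)
    (c : CharOpenSubgroup ΔY → CharOpenSubgroup ΔX)
    (hc : ∀ H', coFreeKernel ρX (c H').toSubgroup ≤ coFreeKernel ρY H'.toSubgroup)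
    (d : CharOpenSubgroup ΔX → CharOpenSubgroup ΔY)
    (hd : ∀ H, coFreeKernel ρY (d H).toSubgroup ≤ coFreeKernel ρX H.toSubgroup)
    (hIA : ∀ (H : CharOpenSubgroup ΔX) (q : PY), ∃ p : PX,
      ((ρY q : Q) : CoFreeQuot ρX H.toSubgroup) = toCoFreeQuot ρX H.toSubgroup p)
    (hopen : ∀ H : CharOpenSubgroup ΔX, IsOpenMap (fbar hf H)) :
    Continuous (Equiv.ofBijective _ (compareHom_bijective hf c hc d hd hIA)).symm := by
  set e := Equiv.ofBijective _ (compareHom_bijective hf c hc d hd hIA) with he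
  rw [CoFreeCompletion.continuous_iff_kerCoord]
  intro H
  -- `f̄_H` is a homeomorphism onto `Π_Y ⧸ K^Y_H`
  let φ : (PX ⧸ CoFreeCompletion.piKer ρX ΔX H) ≃ (PY ⧸ kerY ρX ρY ΔX H) :=
    Equiv.ofBijective _ ⟨fbar_injective hf H, fbar_surjective hf H (hIA H)⟩
  let Φ : (PX ⧸ CoFreeCompletion.piKer ρX ΔX H) ≃ₜ (PY ⧸ kerY ρX ρY ΔX H) :=
    φ.toHomeomorphOfContinuousOpen (continuous_fbar hf H) (hopen H)
  have hΦ : ∀ z, Φ z = fbar hf H z := fun _ => rfl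
  -- coordinate `H` of `e.symm y` = `Φ.symm (projection of coordinate (d H) of y)`
  have hcoord : ∀ y, CoFreeCompletion.kerCoord H (e.symm y) =
      Φ.symm (QuotientGroup.map _ _ (MonoidHom.id PY) (piKer_le_kerY H (hd H))
        (CoFreeCompletion.kerCoord (d H) y)) := by
    intro y
    apply Φ.injective
    rw [Homeomorph.apply_symm_apply, hΦ, fbar_kerCoord hf c hc d hd H (e.symm y)]
    have hy : compareHom f hf c hc (e.symm y) = y := e.apply_symm_apply y
    rw [hy]
  have hπ : Continuous (QuotientGroup.map (CoFreeCompletion.piKer ρY ΔY (d H))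
      (kerY ρX ρY ΔX H) (MonoidHom.id PY) (piKer_le_kerY H (hd H))) := by
    apply (QuotientGroup.isOpenQuotientMap_mk
      (N := CoFreeCompletion.piKer ρY ΔY (d H))).continuous_comp_iff.mp
    exact QuotientGroup.continuous_mk
  have h : (fun y => CoFreeCompletion.kerCoord H (e.symm y)) =
      Φ.symm ∘ (QuotientGroup.map _ _ (MonoidHom.id PY) (piKer_le_kerY H (hd H))) ∘
        CoFreeCompletion.kerCoord (d H) := funext hcoord
  rw [h]
  exact Φ.symm.continuous.comp (hπ.comp (CoFreeCompletion.continuous_kerCoord (d H)))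

variable (f) in
/-- **The comparison as an isomorphism of topological groups `Π_X^{Q/co-fr} ≃ₜ* Π_Y^{Q/co-fr}`**
under: compatibility `ρY ∘ f = ρX`, both cofinality choices, image agreement, and openness of the
descended maps `f̄_H`.  Composed with an identification `Π_Y^{Q/co-fr} ≃ₜ* Π_Y` carrying `η_Y` to the
identity ([AbsTopI] Prop 4.10 (i)), it yields the isomorphism of Prop 4.10 (iii) carrying `η_X` to `f`.
[cite: MochizukiAbsTopI2012, Prop 4.10 (iii) p.60] -/
def compareEquiv (hf : ∀ p, ρY (f p) = ρX p) (c : CharOpenSubgroup ΔY → CharOpenSubgroup ΔX)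
    (hc : ∀ H', coFreeKernel ρX (c H').toSubgroup ≤ coFreeKernel ρY H'.toSubgroup)
    (d : CharOpenSubgroup ΔX → CharOpenSubgroup ΔY)
    (hd : ∀ H, coFreeKernel ρY (d H).toSubgroup ≤ coFreeKernel ρX H.toSubgroup)
    (hIA : ∀ (H : CharOpenSubgroup ΔX) (q : PY), ∃ p : PX,
      ((ρY q : Q) : CoFreeQuot ρX H.toSubgroup) = toCoFreeQuot ρX H.toSubgroup p)
    (hopen : ∀ H : CharOpenSubgroup ΔX, IsOpenMap (fbar hf H)) :
    CoFreeCompletion ρX ΔX ≃ₜ* CoFreeCompletion ρY ΔY :=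
  { MulEquiv.ofBijective (compareHom f hf c hc) (compareHom_bijective hf c hc d hd hIA) with
    continuous_toFun := continuous_compareHom hf c hc
    continuous_invFun := continuous_symm_compareHom hf c hc d hd hIA hopen }

/-- `compareEquiv` is `compareHom` on elements. [cite: MochizukiAbsTopI2012, Prop 4.10 (iii) p.60] -/
@[simp] theorem compareEquiv_apply (hf : ∀ p, ρY (f p) = ρX p)
    (c : CharOpenSubgroup ΔY → CharOpenSubgroup ΔX)
    (hc : ∀ H', coFreeKernel ρX (c H').toSubgroup ≤ coFreeKernel ρY H'.toSubgroup)
    (d : CharOpenSubgroup ΔX → CharOpenSubgroup ΔY)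
    (hd : ∀ H, coFreeKernel ρY (d H).toSubgroup ≤ coFreeKernel ρX H.toSubgroup)
    (hIA : ∀ (H : CharOpenSubgroup ΔX) (q : PY), ∃ p : PX,
      ((ρY q : Q) : CoFreeQuot ρX H.toSubgroup) = toCoFreeQuot ρX H.toSubgroup p)
    (hopen : ∀ H : CharOpenSubgroup ΔX, IsOpenMap (fbar hf H)) (x : CoFreeCompletion ρX ΔX) :
    compareEquiv f hf c hc d hd hIA hopen x = compareHom f hf c hc x := rfl

/-- **Prop 4.10 (iii), abstract form**: given moreover `e_Y : Π_Y^{Q/co-fr} ≃ₜ* Π_Y` with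
`e_Y ∘ η_Y = id` ((i) for `Y`), the composite `e := e_Y ∘ compareEquiv : Π_X^{Q/co-fr} ≃ₜ* Π_Y`
carries `η_X` to `f` — "the natural homomorphism `Π^tp_X → Π^tp_Y` may be reconstructed [...] as the
natural morphism from `Π^tp_X` to the co-free completion of `Π^tp_X` with respect to `Π̂^tp_Y`".
[cite: MochizukiAbsTopI2012, Prop 4.10 (iii) p.60] -/
theorem exists_equiv_toCoFreeCompletion_eq (hf : ∀ p, ρY (f p) = ρX p)
    (c : CharOpenSubgroup ΔY → CharOpenSubgroup ΔX)
    (hc : ∀ H', coFreeKernel ρX (c H').toSubgroup ≤ coFreeKernel ρY H'.toSubgroup)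
    (d : CharOpenSubgroup ΔX → CharOpenSubgroup ΔY)
    (hd : ∀ H, coFreeKernel ρY (d H).toSubgroup ≤ coFreeKernel ρX H.toSubgroup)
    (hIA : ∀ (H : CharOpenSubgroup ΔX) (q : PY), ∃ p : PX,
      ((ρY q : Q) : CoFreeQuot ρX H.toSubgroup) = toCoFreeQuot ρX H.toSubgroup p)
    (hopen : ∀ H : CharOpenSubgroup ΔX, IsOpenMap (fbar hf H))
    (eY : CoFreeCompletion ρY ΔY ≃ₜ* PY) (heY : ∀ q : PY, eY (toCoFreeCompletion ρY ΔY q) = q) :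
    ∃ e : CoFreeCompletion ρX ΔX ≃ₜ* PY, ∀ p : PX, e (toCoFreeCompletion ρX ΔX p) = f p := by
  refine ⟨(compareEquiv f hf c hc d hd hIA hopen).trans eY, fun p => ?_⟩
  change eY (compareEquiv f hf c hc d hd hIA hopen (toCoFreeCompletion ρX ΔX p)) = f p
  rw [compareEquiv_apply, compareHom_toCoFreeCompletion, heY]

end Top

end Literature.AnabelianGeometry.AbsoluteAnabelian.AbsTopI
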